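import Literature.AlgebraicGeometry.ProjectiveSpace.StanleyReisnerHilbertPolynomial
import HarnessLib

/-!
# The degree and leading coefficient of the Hilbert polynomial of `k[Δ]`: `deg P_Δ = dim Δ`,
# leading coefficient `f_{d−1}/(d−1)!`
# (Bruns–Herzog Thm. 5.1.4 (`dim k[Δ] = d`), Thm. 5.1.7, Cor. 5.1.9; Miller–Sturmfels Cor. 1.15;
# Harris, Remark 13.10)

Topic `Literature/AlgebraicGeometry/ProjectiveSpace`, namespace
`Literature.AlgebraicGeometry.ProjectiveSpace`. Lane `lit-hodgefound`, seat `lit-hodgefound-p32`,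
row gen27-#15. Theorems only (no `def`, no named fact). Companion of `StanleyReisnerHilbertPolynomial`.

## The sources, as printed

Bruns–Herzog, *Cohen–Macaulay Rings*, Thm. 5.1.4: "Let `Δ` be a simplicial complex … `dim k[Δ] = d`"
(`d − 1 = dim Δ`); Thm. 5.1.7: "`H(k[Δ], n) = Σ_{i=0}^{d−1} f_i binom(n−1, i)` for `n > 0`";
Cor. 5.1.9: "`e(k[Δ]) = f_{d−1}`". Miller–Sturmfels, Cor. 1.15: "`H(S/I_Δ; t,…,t) =
(1/(1−t)ⁿ) Σ_{i=0}^d f_{i−1} tⁱ (1−t)^{n−i}` where `d = dim(Δ) + 1`". Harris, Remark 13.10: "the degree of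
[the Hilbert polynomial] must be the dimension `k` of `X`" — here `X = A(Δ) ⊂ ℙ(k^σ)` is a union of
linear spaces of dimensions `|F| − 1`, `F ∈ Δ`, so `dim X = d − 1` with `d = max |F|`.

## Dictionary and what is here

As in `StanleyReisnerHilbertPolynomial`: `Δ` a finite family of subsets of `σ`, `f_i` the number of
faces with `i + 1` elements of the complex it generates,
`P_Δ = Σ_{i < |σ|} (f_i / i!) descPochhammer_i(X − 1) ∈ ℚ[X]` the Hilbert polynomial (so that
`H(n) = P_Δ(n)` for `n ≥ 1`). Put `d = max_{F ∈ Δ} |F|` (`= Δ.sup card`, the Krull dimension of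
`k[Δ]`), assumed `≥ 1`.

* `f_i = 0` for `i ≥ d`, and `f_{d−1} = #{F ∈ Δ : |F| = d} ≠ 0` (the top-dimensional faces are members
  of `Δ`).
* **`natDegree P_Δ = d − 1`** (`natDegree_hilbertPolynomial`) and
  **`leadingCoeff P_Δ = f_{d−1}/(d−1)!`** (`leadingCoeff_hilbertPolynomial`): the degree of the
  Hilbert polynomial is the dimension of `A(Δ) ⊂ ℙ`, and `(d−1)!` times its leading coefficient — the
  degree (multiplicity) of `A(Δ)` — is the number `f_{d−1}` of top-dimensional faces.

## References

* [BrunsHerzog1998] W. Bruns, J. Herzog, *Cohen–Macaulay Rings*, rev. ed., CUP 1998, Thm. 5.1.4,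
  Thm. 5.1.7, Cor. 5.1.9.
* [MillerSturmfels2005] E. Miller, B. Sturmfels, *Combinatorial Commutative Algebra*, GTM 227,
  Springer 2005, Cor. 1.15.
* [Harris1992] J. Harris, *Algebraic Geometry: A First Course*, GTM 133, Springer 1992, Remark 13.10.
-/

noncomputable section

open MvPolynomial Module Finset

universe u

namespace Literature.AlgebraicGeometry.ProjectiveSpace

variable {σ : Type*}

/-! ### § 1 The `f`-vector vanishes above the dimension and counts the top faces at it -/

/-- A face of the complex generated by `Δ` has at most `d = max_{F ∈ Δ} |F|` elements.
[cite: BrunsHerzog1998, Def. 5.1.1 (`dim Δ`)] -/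
theorem card_le_sup_of_mem_biUnion_powerset [DecidableEq σ] (Δ : Finset (Finset σ)) {G : Finset σ}
    (hG : G ∈ Δ.biUnion Finset.powerset) : G.card ≤ Δ.sup Finset.card := by
  rw [Finset.mem_biUnion] at hG
  obtain ⟨F, hF, hGF⟩ := hG
  exact (Finset.card_le_card (Finset.mem_powerset.mp hGF)).trans (Finset.le_sup hF)

/-- **`f_i = 0` for `i ≥ d`**: no face has more than `d` elements. [cite: BrunsHerzog1998, Def. 5.1.1
and Thm. 5.1.7] -/
theorem fVector_eq_zero_of_sup_le [DecidableEq σ] (Δ : Finset (Finset σ)) {i : ℕ}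
    (hi : Δ.sup Finset.card ≤ i) :
    ((Δ.biUnion Finset.powerset).filter (fun G => G.card = i + 1)).card = 0 := by
  rw [Finset.card_eq_zero, Finset.filter_eq_empty_iff]
  intro G hG hGi
  have := card_le_sup_of_mem_biUnion_powerset Δ hG
  omega

/-- **The top-dimensional faces are the members of `Δ` of maximal cardinality**: for
`d = max_{F ∈ Δ} |F|`, the faces with `d` elements are exactly the `F ∈ Δ` with `|F| = d`.
[cite: BrunsHerzog1998, Def. 5.1.1 (facets)] -/
theorem filter_biUnion_powerset_card_eq_sup [DecidableEq σ] (Δ : Finset (Finset σ)) {d : ℕ}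
    (hd : Δ.sup Finset.card = d) :
    (Δ.biUnion Finset.powerset).filter (fun G => G.card = d) = Δ.filter (fun F => F.card = d) := by
  ext G
  simp only [Finset.mem_filter, Finset.mem_biUnion, Finset.mem_powerset]
  constructor
  · rintro ⟨⟨F, hF, hGF⟩, hGd⟩
    have hFd : F.card ≤ d := hd ▸ Finset.le_sup hF
    have hGF' : G = F := Finset.eq_of_subset_of_card_le hGF (by omega)
    exact ⟨hGF' ▸ hF, hGd⟩
  · rintro ⟨hG, hGd⟩
    exact ⟨⟨G, hG, subset_rfl⟩, hGd⟩

/-- **`f_{d−1} = #{F ∈ Δ : |F| = d} ≥ 1`** for `d = max |F| ≥ 1`. [cite: BrunsHerzog1998, Def. 5.1.1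
and Cor. 5.1.9] -/
theorem fVector_top_pos [DecidableEq σ] (Δ : Finset (Finset σ)) {d : ℕ}
    (hd : Δ.sup Finset.card = d + 1) :
    0 < (Δ.filter (fun F => F.card = d + 1)).card := by
  have hne : Δ.Nonempty := by
    rw [Finset.nonempty_iff_ne_empty]
    rintro rfl
    simp at hd
  obtain ⟨F, hF, hFd⟩ := Finset.exists_mem_eq_sup Δ hne Finset.card
  exact Finset.card_pos.mpr ⟨F, Finset.mem_filter.mpr ⟨hF, by rw [← hFd, hd]⟩⟩

/-! ### § 2 The summands of `P_Δ` -/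

/-- The `i`-th summand `c · descPochhammer_i(X − 1)` of `P_Δ` with `c ≠ 0` has degree `i` and
leading coefficient `c`. [cite: BrunsHerzog1998, Thm. 5.1.7 (the binomial polynomials)] -/
private theorem natDegree_C_mul_descPochhammer_comp {c : ℚ} (hc : c ≠ 0) (i : ℕ) :
    (Polynomial.C c * (descPochhammer ℚ i).comp (Polynomial.X - 1)).natDegree = i ∧
      (Polynomial.C c * (descPochhammer ℚ i).comp (Polynomial.X - 1)).leadingCoeff = c ∧
        Polynomial.C c * (descPochhammer ℚ i).comp (Polynomial.X - 1) ≠ 0 := by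
  have hX : (Polynomial.X - 1 : Polynomial ℚ) = Polynomial.X - Polynomial.C 1 := by
    rw [Polynomial.C_1]
  have hm : ((descPochhammer ℚ i).comp (Polynomial.X - 1)).Monic := by
    rw [hX]
    exact (monic_descPochhammer ℚ i).comp_X_sub_C 1
  have hdeg : ((descPochhammer ℚ i).comp (Polynomial.X - 1)).natDegree = i := by
    rw [Polynomial.natDegree_comp, descPochhammer_natDegree, hX, Polynomial.natDegree_X_sub_C,
      mul_one]
  refine ⟨by rw [Polynomial.natDegree_C_mul hc, hdeg], by
    rw [Polynomial.leadingCoeff_mul, Polynomial.leadingCoeff_C, hm.leadingCoeff, mul_one],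
    mul_ne_zero (Polynomial.C_ne_zero.mpr hc) hm.ne_zero⟩

/-! ### § 3 Degree and leading coefficient of `P_Δ` -/

/-- The splitting `P_Δ = (top summand) + (rest)` with the rest of degree `< d − 1`.
[cite: BrunsHerzog1998, Thm. 5.1.7] -/
private theorem hilbertPolynomial_split [Fintype σ] [DecidableEq σ] (Δ : Finset (Finset σ)) {d : ℕ}
    (hd : Δ.sup Finset.card = d + 1) :
    (∑ i ∈ range (Fintype.card σ),
        Polynomial.C ((((Δ.biUnion Finset.powerset).filter (fun G => G.card = i + 1)).card : ℚ) /
          (i.factorial : ℚ)) * (descPochhammer ℚ i).comp (Polynomial.X - 1)) =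
      Polynomial.C ((((Δ.biUnion Finset.powerset).filter (fun G => G.card = d + 1)).card : ℚ) /
          (d.factorial : ℚ)) * (descPochhammer ℚ d).comp (Polynomial.X - 1) +
        ∑ i ∈ (range (Fintype.card σ)).erase d,
          Polynomial.C ((((Δ.biUnion Finset.powerset).filter (fun G => G.card = i + 1)).card : ℚ) /
            (i.factorial : ℚ)) * (descPochhammer ℚ i).comp (Polynomial.X - 1) ∧
      (∑ i ∈ (range (Fintype.card σ)).erase d,
          Polynomial.C ((((Δ.biUnion Finset.powerset).filter (fun G => G.card = i + 1)).card : ℚ) /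
            (i.factorial : ℚ)) * (descPochhammer ℚ i).comp (Polynomial.X - 1)).degree < d := by
  have hdmem : d ∈ range (Fintype.card σ) := by
    rw [Finset.mem_range]
    obtain ⟨F, hF, hFd⟩ : ∃ F ∈ Δ, F.card = d + 1 := by
      obtain ⟨F, hF⟩ := Finset.card_pos.mp (fVector_top_pos Δ hd)
      exact ⟨F, (Finset.mem_filter.mp hF).1, (Finset.mem_filter.mp hF).2⟩
    have := Finset.card_le_univ F
    omega
  refine ⟨(Finset.add_sum_erase _ _ hdmem).symm, ?_⟩
  refine (Polynomial.degree_sum_le _ _).trans_lt ((Finset.sup_lt_iff (WithBot.bot_lt_coe d)).mpr ?_)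
  intro i hi
  rw [Finset.mem_erase] at hi
  by_cases hfi : ((Δ.biUnion Finset.powerset).filter (fun G => G.card = i + 1)).card = 0
  · rw [hfi, Nat.cast_zero, zero_div, Polynomial.C_0, zero_mul, Polynomial.degree_zero]
    exact WithBot.bot_lt_coe d
  · have hc : ((((Δ.biUnion Finset.powerset).filter (fun G => G.card = i + 1)).card : ℚ) /
        (i.factorial : ℚ)) ≠ 0 :=
      div_ne_zero (Nat.cast_ne_zero.mpr hfi) (Nat.cast_ne_zero.mpr i.factorial_ne_zero)
    obtain ⟨hdeg, -, hne⟩ := natDegree_C_mul_descPochhammer_comp hc i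
    rw [Polynomial.degree_eq_natDegree hne, hdeg]
    have hid : i < d := by
      rcases lt_or_gt_of_ne hi.1 with h | h
      · exact h
      · exact absurd (fVector_eq_zero_of_sup_le Δ (by omega)) hfi
    exact WithBot.coe_lt_coe.mpr hid

/-- **`deg P_Δ = dim Δ = d − 1`: the degree of the Hilbert polynomial of `k[Δ]` is the dimension of
the union `A(Δ) ⊂ ℙ(k^σ)` of the linear spaces `ℙ(k^F)`, `F ∈ Δ`** (`d = max_{F ∈ Δ} |F| ≥ 1`, the
Krull dimension of `k[Δ]`). [cite: BrunsHerzog1998, Thm. 5.1.4 (`dim k[Δ] = d`) and Thm. 5.1.7]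
[cite: MillerSturmfels2005, Cor. 1.15] [cite: Harris1992, Remark 13.10] -/
theorem natDegree_hilbertPolynomial [Fintype σ] [DecidableEq σ] (Δ : Finset (Finset σ)) {d : ℕ}
    (hd : Δ.sup Finset.card = d + 1) :
    (∑ i ∈ range (Fintype.card σ),
        Polynomial.C ((((Δ.biUnion Finset.powerset).filter (fun G => G.card = i + 1)).card : ℚ) /
          (i.factorial : ℚ)) * (descPochhammer ℚ i).comp (Polynomial.X - 1)).natDegree = d := by
  obtain ⟨hsplit, hrest⟩ := hilbertPolynomial_split Δ hd
  have hc : ((((Δ.biUnion Finset.powerset).filter (fun G => G.card = d + 1)).card : ℚ) /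
      (d.factorial : ℚ)) ≠ 0 := by
    rw [filter_biUnion_powerset_card_eq_sup Δ hd]
    exact div_ne_zero (Nat.cast_ne_zero.mpr (fVector_top_pos Δ hd).ne')
      (Nat.cast_ne_zero.mpr d.factorial_ne_zero)
  obtain ⟨hdeg, -, hne⟩ := natDegree_C_mul_descPochhammer_comp hc d
  rw [hsplit, Polynomial.natDegree_add_eq_left_of_degree_lt, hdeg]
  rw [Polynomial.degree_eq_natDegree hne, hdeg]
  exact hrest

/-- **The leading coefficient of `P_Δ` is `f_{d−1}/(d−1)!` with `f_{d−1} = #{F ∈ Δ : |F| = d}` the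
number of top-dimensional faces** — `(d−1)! · lc(P_Δ) = e(k[Δ]) = f_{d−1}`, the degree of
`A(Δ) ⊂ ℙ(k^σ)` (`d = max_{F ∈ Δ} |F| ≥ 1`). [cite: BrunsHerzog1998, Cor. 5.1.9 (`e(k[Δ]) = f_{d−1}`)
and Thm. 5.1.7] [cite: MillerSturmfels2005, Cor. 1.15] -/
theorem leadingCoeff_hilbertPolynomial [Fintype σ] [DecidableEq σ] (Δ : Finset (Finset σ)) {d : ℕ}
    (hd : Δ.sup Finset.card = d + 1) :
    (∑ i ∈ range (Fintype.card σ),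
        Polynomial.C ((((Δ.biUnion Finset.powerset).filter (fun G => G.card = i + 1)).card : ℚ) /
          (i.factorial : ℚ)) * (descPochhammer ℚ i).comp (Polynomial.X - 1)).leadingCoeff =
      ((Δ.filter (fun F => F.card = d + 1)).card : ℚ) / (d.factorial : ℚ) := by
  obtain ⟨hsplit, hrest⟩ := hilbertPolynomial_split Δ hd
  have hc : ((((Δ.biUnion Finset.powerset).filter (fun G => G.card = d + 1)).card : ℚ) /
      (d.factorial : ℚ)) ≠ 0 := by
    rw [filter_biUnion_powerset_card_eq_sup Δ hd]
    exact div_ne_zero (Nat.cast_ne_zero.mpr (fVector_top_pos Δ hd).ne')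
      (Nat.cast_ne_zero.mpr d.factorial_ne_zero)
  obtain ⟨hdeg, hlc, hne⟩ := natDegree_C_mul_descPochhammer_comp hc d
  rw [hsplit, Polynomial.leadingCoeff_add_of_degree_lt', hlc, filter_biUnion_powerset_card_eq_sup Δ hd]
  rw [Polynomial.degree_eq_natDegree hne, hdeg]
  exact hrest

/-! ### § 4 Examples -/

/-- **Two skew lines of `ℙ³`: `d = 2`, `P = 2X + 2` has degree `1 = dim` and leading coefficient
`2 = f_1` (two lines, degree `2`).** [cite: Harris1992, Exercise 13.8 (i) and Remark 13.10]
[cite: BrunsHerzog1998, Cor. 5.1.9] -/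
theorem natDegree_hilbertPolynomial_two_skew_lines :
    (∑ i ∈ range (Fintype.card (Fin 4)),
        Polynomial.C ((((({{0, 1}, {2, 3}} : Finset (Finset (Fin 4))).biUnion Finset.powerset).filter
          (fun G => G.card = i + 1)).card : ℚ) / (i.factorial : ℚ)) *
          (descPochhammer ℚ i).comp (Polynomial.X - 1)).natDegree = 1 ∧
    (∑ i ∈ range (Fintype.card (Fin 4)),
        Polynomial.C ((((({{0, 1}, {2, 3}} : Finset (Finset (Fin 4))).biUnion Finset.powerset).filter
          (fun G => G.card = i + 1)).card : ℚ) / (i.factorial : ℚ)) *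
          (descPochhammer ℚ i).comp (Polynomial.X - 1)).leadingCoeff = 2 := by
  have hd : ({{0, 1}, {2, 3}} : Finset (Finset (Fin 4))).sup Finset.card = 1 + 1 := by decide
  refine ⟨natDegree_hilbertPolynomial _ hd, ?_⟩
  rw [leadingCoeff_hilbertPolynomial _ hd,
    show (({{0, 1}, {2, 3}} : Finset (Finset (Fin 4))).filter (fun F => F.card = 1 + 1)).card = 2 by
      decide]
  norm_num

/-- **The boundary of the coordinate tetrahedron of `ℙ³`: `d = 3`, `P = 2X² + 2` has degree
`2 = dim` and leading coefficient `2 = f_2/2!` (four planes: degree `4 = 2! · 2`).**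
[cite: BrunsHerzog1998, Cor. 5.1.9 and Thm. 5.1.7] [cite: Harris1992, Remark 13.10] -/
theorem natDegree_hilbertPolynomial_coordinate_tetrahedron_boundary :
    (∑ i ∈ range (Fintype.card (Fin 4)),
        Polynomial.C ((((({{1, 2, 3}, {0, 2, 3}, {0, 1, 3}, {0, 1, 2}} : Finset (Finset (Fin 4))).biUnion
          Finset.powerset).filter (fun G => G.card = i + 1)).card : ℚ) / (i.factorial : ℚ)) *
          (descPochhammer ℚ i).comp (Polynomial.X - 1)).natDegree = 2 ∧
    (∑ i ∈ range (Fintype.card (Fin 4)),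
        Polynomial.C ((((({{1, 2, 3}, {0, 2, 3}, {0, 1, 3}, {0, 1, 2}} : Finset (Finset (Fin 4))).biUnion
          Finset.powerset).filter (fun G => G.card = i + 1)).card : ℚ) / (i.factorial : ℚ)) *
          (descPochhammer ℚ i).comp (Polynomial.X - 1)).leadingCoeff = 2 := by
  have hd : ({{1, 2, 3}, {0, 2, 3}, {0, 1, 3}, {0, 1, 2}} : Finset (Finset (Fin 4))).sup Finset.card =
      2 + 1 := by decide
  refine ⟨natDegree_hilbertPolynomial _ hd, ?_⟩
  rw [leadingCoeff_hilbertPolynomial _ hd,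
    show (({{1, 2, 3}, {0, 2, 3}, {0, 1, 3}, {0, 1, 2}} : Finset (Finset (Fin 4))).filter
      (fun F => F.card = 2 + 1)).card = 4 by decide]
  norm_num [Nat.factorial]

end Literature.AlgebraicGeometry.ProjectiveSpace
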